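import Mathlib
import Literature.Computability.Complexity.RangeAvoidance
import Literature.Computability.Complexity.SignDegreeXor
import HarnessLib.Audit
import Summits.PneNP.PneNP.Theorems.PstarTyped
import Summits.PneNP.PneNP.Theorems.PstarSA2Blind
import Summits.PneNP.PneNP.Theorems.PstarSALevel

/-!
# T21.1c target: the mixed Sherali–Adams + SDP hierarchy on typed `P⋆` instances (cell `pnp-ideate`, ROUND-21, p3)

FRONTIER range-avoidance ladder, restricted-model side of rung F-N3 — nothing here bears on `P` vs `NP`.

Benabbas–Georgiou–Magen–Tulsiani's theorem (ToC 2012, Thm 4.3) is about the MIXED hierarchy: level-`t` Sherali–Adams local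
laws PLUS positive semidefiniteness of the level-2 moment matrix of their singleton / pair marginals ("Sherali–Adams SDP",
their Lemma 2.3 / Claim 4.4).  This is the class that contains every degree-2 spectral / SDP certificate (the ROUND-19 isolation
certificate included) on top of all local LP reasoning.  This file types the cell's target for it:
* `BoundaryExpandingQ a b r I` — ratio-parametrised boundary expansion (`a·|J| ≤ b·|bdry J|` for `|J| ≤ r`);
  `PstarSALevel.BoundaryExpanding = BoundaryExpandingQ 3 2` and ratio `7/4` implies ratio `3/2`;
* `SASDPFeasible t I y` — an SA family as in `PstarSALevel.SAFeasible` whose singleton and pair cylinder masses form a PSD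
  `PstarSA2Blind.momentMatrix`; sanity: it implies `SAFeasible`, and range points are feasible at every level (Dirac family ⇒
  product moment matrix ⇒ `posSemidef_momentMatrix_product`);
* `TypedSASDPLinearLevel` (conjecture / target T21.1c): on typed pure-`P⋆` instances that are `(r, 7/4)`-boundary expanding with
  simple overlaps, every fibre is SA+SDP feasible at level `r / c`.  The two hypotheses beyond T21.1 are BGMT Claim 3.4's genuine
  ones: pair laws of non-co-occurring variables must factor (product of TYPE biases `½`, `1/√2`), which needs `G − {i,i′}` still
  peelable (ratio `> 5/3`, their `ε > 2/3`) and no two constraints sharing two variables; co-occurring pairs factor by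
  `PstarPairwise.pairwiseIndep_lp`.  PSD then follows from `posSemidef_momentMatrix_product`.
-/

set_option linter.dupNamespace false

open Finset Matrix
open Literature.Computability.Complexity
open Summit.PneNP.PneNP.Theorems.PstarTyped (Typed)
open Summit.PneNP.PneNP.Theorems.PstarSA2Blind (momentMatrix posSemidef_momentMatrix_product)
open Summit.PneNP.PneNP.Theorems.PstarSALevel (cyl varSet bdry SAFeasible BoundaryExpanding SimpleOverlap)

namespace Summit.PneNP.PneNP.Theorems.PstarSASDPLevel

variable {k n m : ℕ}

/-- Ratio-parametrised boundary expansion: every set `J` of at most `r` outputs has `a·|J| ≤ b·|bdry J|`. -/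
def BoundaryExpandingQ (a b r : ℕ) (I : LocalMap k n m) : Prop :=
  ∀ J : Finset (Fin m), J.card ≤ r → a * J.card ≤ b * (bdry I J).card

/-- `BoundaryExpanding` is the ratio-`3/2` case. -/
theorem boundaryExpanding_iff_Q (r : ℕ) (I : LocalMap k n m) : BoundaryExpanding r I ↔ BoundaryExpandingQ 3 2 r I :=
  Iff.rfl

/-- Ratio `7/4` implies ratio `3/2`. -/
theorem boundaryExpanding_of_Q74 {r : ℕ} {I : LocalMap k n m} (h : BoundaryExpandingQ 7 4 r I) :
    BoundaryExpanding r I := by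
  intro J hJ
  have := h J hJ
  omega

/-- The singleton pseudo-marginal `Pr[x_v = 1]` of an SA family `D`. -/
def single (D : Finset (Fin n) → (Fin n → Bool) → ℝ) (v : Fin n) : ℝ := cyl (D {v}) {v} fun _ => true

/-- The pair pseudo-marginal `Pr[x_v = x_w = 1]` of an SA family `D`. -/
def pair (D : Finset (Fin n) → (Fin n → Bool) → ℝ) (v w : Fin n) : ℝ := cyl (D {v, w}) {v, w} fun _ => true

/-- **Level-`t` Sherali–Adams + SDP feasibility** of `I(x) = y`: an SA family (non-negative normalised laws on all sets of at
most `t` variables, consistent under restriction, supported on assignments satisfying the dominated output constraints) whose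
level-2 moment matrix of singleton / pair pseudo-marginals is positive semidefinite. -/
def SASDPFeasible (t : ℕ) (I : LocalMap k n m) (y : Fin m → Bool) : Prop :=
  ∃ D : Finset (Fin n) → (Fin n → Bool) → ℝ,
    (∀ S, S.card ≤ t → (∀ x, 0 ≤ D S x) ∧ ∑ x, D S x = 1) ∧
    (∀ S T, T ⊆ S → S.card ≤ t → ∀ a, cyl (D S) T a = cyl (D T) T a) ∧
    (∀ S (j : Fin m), S.card ≤ t → varSet I j ⊆ S → ∀ x, D S x ≠ 0 → I.eval x j = y j) ∧
    (momentMatrix (single D) (pair D)).PosSemidef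

/-- SA+SDP feasibility implies SA feasibility. -/
theorem SASDPFeasible.toSAFeasible {t : ℕ} {I : LocalMap k n m} {y : Fin m → Bool} (h : SASDPFeasible t I y) :
    SAFeasible t I y := by
  obtain ⟨D, h1, h2, h3, -⟩ := h
  exact ⟨D, h1, h2, h3⟩

/-- Cylinder masses of a Dirac law. -/
theorem cyl_dirac (x₀ : Fin n → Bool) (T : Finset (Fin n)) (a : Fin n → Bool) :
    cyl (fun x => if x = x₀ then (1 : ℝ) else 0) T a = if (∀ i ∈ T, x₀ i = a i) then 1 else 0 := by
  classical
  simp [cyl, Finset.sum_ite_eq', Finset.mem_filter]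

/-- **Range points are SA+SDP feasible at every level** (Dirac family at a preimage; its moment matrix is the product one). -/
theorem sasdpFeasible_of_mem_range (t : ℕ) (I : LocalMap k n m) {y : Fin m → Bool} (h : y ∈ I.range) :
    SASDPFeasible t I y := by
  classical
  obtain ⟨x₀, hx₀⟩ := h
  set D : Finset (Fin n) → (Fin n → Bool) → ℝ := fun _ x => if x = x₀ then 1 else 0 with hD
  have hsingle : single D = fun v => if x₀ v = true then (1 : ℝ) else 0 := by
    funext v
    simp [single, hD, cyl_dirac]
  have hpair : pair D = fun v w => single D v * single D w := by
    funext v w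
    rw [hsingle]
    simp only [pair, hD, cyl_dirac, Finset.mem_insert, Finset.mem_singleton, forall_eq_or_imp, forall_eq]
    cases x₀ v <;> cases x₀ w <;> simp
  refine ⟨D, fun S _ => ⟨fun x => ?_, by simp [hD]⟩, fun S T _ _ a => rfl, fun S j _ _ x hx => ?_, ?_⟩
  · show (0 : ℝ) ≤ if x = x₀ then 1 else 0
    split_ifs <;> norm_num
  · have hxx : x = x₀ := by
      by_contra hne
      exact hx (if_neg hne)
    subst hxx
    exact congrFun hx₀ j
  · rw [hpair]
    refine posSemidef_momentMatrix_product (single D) fun v => ?_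
    rw [hsingle]
    by_cases hv : x₀ v = true <;> simp [hv]

/-- Level `n` is exact for SA+SDP as well. -/
theorem mem_range_of_sasdpFeasible {t : ℕ} (I : LocalMap k n m) {y : Fin m → Bool} (h : SASDPFeasible t I y)
    (ht : n ≤ t) : y ∈ I.range :=
  PstarSALevel.mem_range_of_saFeasible I h.toSAFeasible ht

/-- **T21.1c (conjecture / cell target).**  There is an absolute `c > 0` such that on every typed pure-`P⋆` instance that is
`(r, 7/4)`-boundary expanding with simple overlaps, the fibre of every target is SA+SDP feasible at level `r / c`.  (BGMT
Thm 4.3 transferred with type-consistent biases `½`, `1/√2` in place of balance: pair laws factor into products of type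
biases — co-occurring pairs by `PstarPairwise.pairwiseIndep_lp`, other pairs by consistency between `{i,i′}` and its closure,
BGMT Claim 3.4, which needs the stronger ratio and simple overlaps — and then `posSemidef_momentMatrix_product` applies.) -/
@[conjecture] def TypedSASDPLinearLevel : Prop :=
  ∃ c : ℕ, 0 < c ∧ ∀ (n m r : ℕ) (I : LocalMap 4 n m), I.IsPure xorAndPred → Typed I →
    BoundaryExpandingQ 7 4 r I → SimpleOverlap I → ∀ y : Fin m → Bool, SASDPFeasible (r / c) I y

end Summit.PneNP.PneNP.Theorems.PstarSASDPLevel
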